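import Mathlib

/-!
# T5LocalHermitian — local hermitian spaces for the Tier-5 sub-step N2 (support file of seat p3)

Cell `pub-hodge-repro2`, README §7 (Tier 5, discharge (N)); support for route-3's `route/T5-route-3.md`
rows A2 (W₃₄ ≅ W₁₂), A6 (necessity of W₃₄ ≅ W₁₂ for (N)) and B4/B5 (the tower `V_v ≅ V′_v ⊕ ℍ`, the
anisotropic places). Prose: `route/T5-SUPPORT-p3.md`. This file: the invariant d₀, the Witt-tower
constancy, the matrix facts, and the printed LOCAL classification as a model (§1–§3); the conservation
relation, the local selection rule and the global classification are in `T5LocalSelection.lean` (§4–§5).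

The printed inputs enter as *fields of structures* (Props), never as axioms:
* Shimura, «Arithmetic of Hermitian forms», Doc. Math. 13 (2008) 739–774 — §1.2 (p. 744) the invariant
  d₀(ϕ) = (−1)^{n/2}·det or (−1)^{(n−1)/2}·det in F^×/N_{K/F}(K^×); §1.4 (p. 744) Witt decomposition, core
  dimension, d₀(ϕ) = d₀(ζ); Lemma 1.6 (p. 745) LOCAL classification by (dim, d₀); (1.15) (p. 747) n = 2:
  core dimension 0 ⟺ 1 ∈ d₀(ϕ); §2.1 (p. 747) t_v ≤ 2; Theorem 2.2 (p. 748) the global classification.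
* Harris–Kudla–Sweet, J. AMS 9 (1996), introduction pp. 942–943 (two classes per dimension, distinguished by
  (−1)^{m(m−1)/2} det V · N E^×) and §5 p. 964 («since det(V + V_{r,r}) = (−1)^r det V, the sign ε(V_m) is
  constant as V_m varies in a tower»).
* Gong–Grenié, Ann. Fac. Sci. Toulouse 20 (2011), p. 175 (Witt towers V^±_m, Hasse invariant
  ε(V) = ε_{E/F}((−1)^{m(m−1)/2} det V)) — the same normalisation as Shimura's d₀ and HKS's ε(V).

MODEL. At a non-split finite place v the class group F_v^×/N(K_v^×) has order 2; the model carries the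
classes through a commutative group `G` (specialised to `ℤˣ` via the quadratic character, as in the
cell's `T4GroupData.LocalSymbols`), the class of −1 as an explicit element `negOne` (NOT assumed to be the
non-trivial class: −1 may or may not be a local norm), and the spaces as an abstract type with
dimension / determinant class / isometry / «⊕ hyperbolic plane» / core dimension. Everything below the
printed fields is proved.
-/

namespace Summit.Ventures.HodgeRepro2.T5LocalHermitian

open Matrix

/-! ## §1. Shimura's invariant d₀ and the Witt-tower constancy -/

/-- Shimura 2008 §1.2 / HKS96 p. 943 / Gong–Grenié p. 175: the invariant `d₀(n, d) = (−1)^{n(n−1)/2}·d`,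
with `negOne` the class of −1 in the class group `G = F^×/N(K^×)` and `d` the class of the determinant. -/
def d0 {G : Type*} [CommGroup G] (negOne : G) (n : ℕ) (d : G) : G :=
  negOne ^ (n * (n - 1) / 2) * d

/-- `(n+2)(n+1)/2 = n(n−1)/2 + (2n+1)` in `ℕ` (truncated subtraction is harmless: `n(n−1)` is `0` at `n = 0`). -/
theorem choose_two_add_two (n : ℕ) : (n + 2) * (n + 2 - 1) / 2 = n * (n - 1) / 2 + (2 * n + 1) := by
  have h : (n + 2) * (n + 2 - 1) = n * (n - 1) + 2 * (2 * n + 1) := by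
    rcases n with _ | m
    · norm_num
    · rw [show m + 1 + 2 - 1 = m + 2 by omega, show m + 1 - 1 = m by omega]
      ring
  rw [h, Nat.add_mul_div_left _ _ (by norm_num : 0 < 2)]

/-- Witt-tower constancy (HKS96 p. 964 ll. 1205–1209; Shimura §1.4 «d₀(ϕ) = d₀(ζ)»): adding a hyperbolic
plane multiplies the determinant class by the class of −1 and raises the dimension by 2; `d₀` is unchanged.
Only `negOne² = 1` is used (true for the class of −1 in any `F^×/N`). -/
theorem d0_add_two_negOne_mul {G : Type*} [CommGroup G] (negOne : G) (h1 : negOne * negOne = 1)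
    (n : ℕ) (d : G) : d0 negOne (n + 2) (negOne * d) = d0 negOne n d := by
  unfold d0
  rw [choose_two_add_two, pow_add, pow_add, pow_mul, pow_one]
  have h3 : (negOne ^ 2) ^ n = 1 := by rw [pow_two, h1, one_pow]
  rw [h3, one_mul, mul_assoc, ← mul_assoc negOne negOne d, h1, one_mul]

/-- The dictionary Shimura §1.2 ↔ HKS/Gong–Grenié: for even `n`, `n(n−1)/2 ≡ n/2 (mod 2)`. -/
theorem even_choose_two_iff_of_even {n : ℕ} (hn : Even n) :
    Even (n * (n - 1) / 2) ↔ Even (n / 2) := by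
  obtain ⟨k, rfl⟩ := hn
  rcases k with _ | k
  · simp
  · have h : (k + 1 + (k + 1)) * (k + 1 + (k + 1) - 1) / 2 = (k + 1) * (2 * k + 1) := by
      rw [show k + 1 + (k + 1) - 1 = 2 * k + 1 by omega, show k + 1 + (k + 1) = 2 * (k + 1) by ring,
        mul_assoc, Nat.mul_div_cancel_left _ (by norm_num : 0 < 2)]
    rw [h, show (k + 1 + (k + 1)) / 2 = k + 1 by omega, Nat.even_mul]
    constructor
    · rintro (h | h)
      · exact h
      · exact absurd h (by rw [Nat.not_even_iff_odd]; exact ⟨k, rfl⟩)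
    · exact fun h => Or.inl h

/-- The dictionary Shimura §1.2 ↔ HKS/Gong–Grenié: for odd `n`, `n(n−1)/2 ≡ (n−1)/2 (mod 2)`. -/
theorem even_choose_two_iff_of_odd {n : ℕ} (hn : Odd n) :
    Even (n * (n - 1) / 2) ↔ Even ((n - 1) / 2) := by
  obtain ⟨k, rfl⟩ := hn
  have h : (2 * k + 1) * (2 * k + 1 - 1) / 2 = (2 * k + 1) * k := by
    rw [show 2 * k + 1 - 1 = 2 * k by omega, mul_comm (2 * k + 1) (2 * k), mul_assoc,
      Nat.mul_div_cancel_left _ (by norm_num : 0 < 2), mul_comm]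
  rw [h, show (2 * k + 1 - 1) / 2 = k by omega, Nat.even_mul]
  constructor
  · rintro (h | h)
    · exact absurd h (by rw [Nat.not_even_iff_odd]; exact ⟨k, rfl⟩)
    · exact h
  · exact fun h => Or.inr h

/-- In `ℤˣ`, `(−1)^a = (−1)^b` as soon as `a` and `b` have the same parity. -/
theorem neg_one_pow_eq_of_even_iff {a b : ℕ} (h : Even a ↔ Even b) :
    ((-1 : ℤˣ) ^ a) = (-1) ^ b := by
  rcases Nat.even_or_odd a with ha | ha
  · exact ha.neg_one_pow.trans (h.mp ha).neg_one_pow.symm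
  · have hb : Odd b := by
      rcases Nat.even_or_odd b with hb | hb
      · exact absurd (h.mpr hb) (Nat.not_even_iff_odd.mpr ha)
      · exact hb
    exact ha.neg_one_pow.trans hb.neg_one_pow.symm

/-- Shimura §1.2 as printed, even case: `d₀ = (−1)^{n/2}·det` (in the `ℤˣ`-model with `negOne = −1`). -/
theorem d0_eq_of_even {n : ℕ} (hn : Even n) (d : ℤˣ) :
    d0 (-1 : ℤˣ) n d = (-1) ^ (n / 2) * d := by
  unfold d0
  congr 1
  exact neg_one_pow_eq_of_even_iff (even_choose_two_iff_of_even hn)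

/-- Shimura §1.2 as printed, odd case: `d₀ = (−1)^{(n−1)/2}·det` (in the `ℤˣ`-model with `negOne = −1`). -/
theorem d0_eq_of_odd {n : ℕ} (hn : Odd n) (d : ℤˣ) :
    d0 (-1 : ℤˣ) n d = (-1) ^ ((n - 1) / 2) * d := by
  unfold d0
  congr 1
  exact neg_one_pow_eq_of_even_iff (even_choose_two_iff_of_odd hn)

/-- `d₀` in dimension 1 is the determinant class. -/
@[simp] theorem d0_one {G : Type*} [CommGroup G] (negOne : G) (d : G) : d0 negOne 1 d = d := by
  simp [d0]

/-- `d₀` in dimension 2 is `(−1)·det`. -/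
@[simp] theorem d0_two {G : Type*} [CommGroup G] (negOne : G) (d : G) : d0 negOne 2 d = negOne * d := by
  simp [d0]

/-- `d₀` in dimension 3 is `(−1)^3·det = (−1)·det` (given `negOne² = 1`). -/
theorem d0_three {G : Type*} [CommGroup G] (negOne : G) (h1 : negOne * negOne = 1) (d : G) :
    d0 negOne 3 d = negOne * d := by
  have h3 : negOne ^ (3 * (3 - 1) / 2) = negOne := by
    rw [show 3 * (3 - 1) / 2 = 3 by norm_num, pow_succ, pow_two, h1, one_mul]
  rw [d0, h3]

/-! ## §2. The matrix-level facts behind «det(V ⊕ ℍ) = −det V» -/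

/-- The hyperbolic plane `ℍ = !![0, 1; 1, 0]`. -/
def hyperbolicPlane (K : Type*) [CommRing K] : Matrix (Fin 2) (Fin 2) K := !![0, 1; 1, 0]

/-- `det ℍ = −1`. -/
theorem det_hyperbolicPlane (K : Type*) [CommRing K] : (hyperbolicPlane K).det = -1 := by
  simp [hyperbolicPlane, Matrix.det_fin_two_of]

/-- HKS96 p. 964: «det(V + V_{r,r}) = (−1)^r det V» for `r = 1` — the Gram matrix of `V ⊕ ℍ` is the block
matrix `H ⊕ ℍ`, and its determinant is `−det H`. -/
theorem det_fromBlocks_hyperbolicPlane {K : Type*} [CommRing K] {n : ℕ} (H : Matrix (Fin n) (Fin n) K) :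
    (Matrix.fromBlocks H 0 0 (hyperbolicPlane K)).det = -H.det := by
  rw [Matrix.det_fromBlocks_zero₂₁, det_hyperbolicPlane, mul_neg, mul_one]

/-- `ℍ` is fixed by any ring involution `ρ` composed with transposition (it is hermitian for every `ρ`). -/
theorem hyperbolicPlane_map_transpose {K : Type*} [CommRing K] (ρ : K →+* K) :
    ((hyperbolicPlane K).map ρ).transpose = hyperbolicPlane K := by
  ext i j
  fin_cases i <;> fin_cases j <;> simp [hyperbolicPlane]

/-- If `H` is hermitian for `ρ` (`(H.map ρ)ᵀ = H`, the cell's `IsHermitianForm` convention), so is `H ⊕ ℍ`. -/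
theorem fromBlocks_hyperbolicPlane_hermitian {K : Type*} [CommRing K] (ρ : K →+* K) {n : ℕ}
    (H : Matrix (Fin n) (Fin n) K) (hH : (H.map ρ).transpose = H) :
    ((Matrix.fromBlocks H 0 0 (hyperbolicPlane K)).map ρ).transpose =
      Matrix.fromBlocks H 0 0 (hyperbolicPlane K) := by
  rw [Matrix.fromBlocks_map, Matrix.fromBlocks_transpose, hH, hyperbolicPlane_map_transpose]
  simp only [Matrix.map_zero _ (map_zero ρ), Matrix.transpose_zero]

/-- The Gram determinant of an orthogonal sum of two lines `⟨a⟩ ⊕ ⟨b⟩` is `a·b`. -/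
theorem det_diagonal_two {K : Type*} [CommRing K] (a b : K) :
    (Matrix.diagonal ![a, b]).det = a * b := by
  simp [Matrix.det_diagonal, Fin.prod_univ_two]

/-- The datum of T5-route-3 row A2: with `e₁₀₁ = u·e₁₁₁` and `e₁₁₀ = u⁻¹·e₁₀₀` (`u ≠ 0`) the Gram
determinants of `W₃₄ = ⟨e₁₀₁⟩ ⊕ ⟨e₁₁₀⟩` and `W₁₂ = ⟨e₁₁₁⟩ ⊕ ⟨e₁₀₀⟩` are EQUAL as elements of the field —
so `d₀(W₃₄) = d₀(W₁₂)` globally, not only class by class. -/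
theorem det_diagonal_two_scale {K : Type*} [Field K] (u e₁ e₂ : K) (hu : u ≠ 0) :
    (Matrix.diagonal ![u * e₁, u⁻¹ * e₂]).det = (Matrix.diagonal ![e₁, e₂]).det := by
  rw [det_diagonal_two, det_diagonal_two]
  field_simp

/-! ## §3. The printed LOCAL classification as a model (non-split finite place) -/

/-- The printed local theory at a NON-SPLIT finite place `v` of `F⁺` (Shimura 2008 Lemma 1.6, §1.4, (1.15),
§2.1), over an abstract type `X` of non-degenerate hermitian `K_v`-spaces. `det x : ℤˣ` is the class of the
determinant under the quadratic character `χ_v : F_v^×/N(K_v^×) ≅ ℤˣ`; `negOne = χ_v(−1)`. -/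
structure LocalModel (X : Type*) where
  /-- the class `χ_v(−1)` of `−1` (a local norm or not — both cases occur) -/
  negOne : ℤˣ
  /-- `dim_{K_v}` -/
  dim : X → ℕ
  /-- the determinant class `χ_v(det ϕ)` -/
  det : X → ℤˣ
  /-- isometry of hermitian spaces -/
  Isom : X → X → Prop
  /-- `x ↦ x ⊕ ℍ` -/
  addHyp : X → X
  /-- `dim (x ⊕ ℍ) = dim x + 2` -/
  dim_addHyp : ∀ x, dim (addHyp x) = dim x + 2
  /-- `det (x ⊕ ℍ) = (−1)·det x` (HKS96 p. 964; `det_fromBlocks_hyperbolicPlane`) -/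
  det_addHyp : ∀ x, det (addHyp x) = negOne * det x
  /-- the core dimension `t` of Shimura §1.4 (dimension of the anisotropic kernel) -/
  core : X → ℕ
  /-- Shimura (1.8a): `dim = 2r + t` -/
  core_mod_two : ∀ x, core x % 2 = dim x % 2
  /-- Shimura §2.1 p. 747: `t_v ≤ 2` -/
  core_le_two : ∀ x, core x ≤ 2
  /-- Shimura 2008, Lemma 1.6 (p. 745): «Two hermitian spaces (V, ϕ) and (V′, ϕ′) in the local case are
  isomorphic if and only if dim(V) = dim(V′) and d₀(ϕ) = d₀(ϕ′).» -/
  lemma16 : ∀ x y, Isom x y ↔ (dim x = dim y ∧ d0 negOne (dim x) (det x) = d0 negOne (dim y) (det y))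
  /-- Shimura 2008, (1.15) (p. 747), `n = 2`: «B ≅ M₂(F) ⟺ t = 0 ⟺ 1 ∈ d₀(ϕ)» -/
  core_eq_zero_iff : ∀ x, dim x = 2 → (core x = 0 ↔ d0 negOne 2 (det x) = 1)

namespace LocalModel

variable {X : Type*} (M : LocalModel X)

/-- `χ_v(−1)² = 1` — automatic in `ℤˣ`. -/
theorem negOne_sq : M.negOne * M.negOne = 1 := by
  rcases Int.units_eq_one_or M.negOne with h | h <;> simp [h]

/-- The tower sign / Hasse invariant `ε(x) = χ_v(d₀(x))` (Gong–Grenié p. 175; HKS96 `ε(V)`). -/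
def towerSign (x : X) : ℤˣ := d0 M.negOne (M.dim x) (M.det x)

/-- Lemma 1.6 restated: isometric ⟺ same dimension and same tower sign. -/
theorem isom_iff (x y : X) : M.Isom x y ↔ (M.dim x = M.dim y ∧ M.towerSign x = M.towerSign y) :=
  M.lemma16 x y

/-- The tower sign is constant along a Witt tower (HKS96 p. 964; Shimura §1.4). -/
theorem towerSign_addHyp (x : X) : M.towerSign (M.addHyp x) = M.towerSign x := by
  unfold towerSign
  rw [M.dim_addHyp, M.det_addHyp, d0_add_two_negOne_mul _ M.negOne_sq]

/-- Row B4 of T5-route-3 in general form: `x ≅ y ⊕ ℍ ⟺ dim x = dim y + 2 ∧ d₀(x) = d₀(y)`. -/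
theorem isom_addHyp_iff (x y : X) :
    M.Isom x (M.addHyp y) ↔ (M.dim x = M.dim y + 2 ∧ M.towerSign x = M.towerSign y) := by
  rw [M.isom_iff, M.dim_addHyp, M.towerSign_addHyp]

/-- Row B4 of T5-route-3 as used: `dim V = 3`, `dim V′ = 1`; then `V ≅ V′ ⊕ ℍ ⟺ det V = (−1)·det V′`
(«disc V′ = disc V», i.e. `d₀(V) = d₀(V′)`, ⟺ `det V_v = −det V′_v`). -/
theorem isom_addHyp_iff_of_dim_three_one (V V' : X) (hV : M.dim V = 3) (hV' : M.dim V' = 1) :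
    M.Isom V (M.addHyp V') ↔ M.det V = M.negOne * M.det V' := by
  rw [M.isom_addHyp_iff, hV, hV']
  simp only [true_and, towerSign, hV, hV', d0_three _ M.negOne_sq, d0_one]
  constructor
  · intro h
    calc M.det V = M.negOne * (M.negOne * M.det V) := by rw [← mul_assoc, M.negOne_sq, one_mul]
      _ = M.negOne * M.det V' := by rw [h]
  · intro h
    rw [h, ← mul_assoc, M.negOne_sq, one_mul]

/-- Two-dimensional spaces: isometric ⟺ same determinant class (the «two classes per dimension» of
HKS96 p. 943 / Gong–Grenié p. 175 at `m = 2`). -/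
theorem isom_iff_of_dim_two (x y : X) (hx : M.dim x = 2) (hy : M.dim y = 2) :
    M.Isom x y ↔ M.det x = M.det y := by
  rw [M.isom_iff, hx, hy]
  simp only [true_and, towerSign, hx, hy, d0_two]
  constructor
  · intro h
    calc M.det x = M.negOne * (M.negOne * M.det x) := by rw [← mul_assoc, M.negOne_sq, one_mul]
      _ = M.negOne * (M.negOne * M.det y) := by rw [h]
      _ = M.det y := by rw [← mul_assoc, M.negOne_sq, one_mul]
  · intro h
    rw [h]

/-- Row B5 of T5-route-3 (the anisotropic places): a two-dimensional space is anisotropic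
(`core = 2`) ⟺ `d₀ ≠ 1` ⟺ it is not the hyperbolic plane's class (Shimura (1.15) + (1.8a) + `t ≤ 2`). -/
theorem core_eq_two_iff_of_dim_two (x : X) (hx : M.dim x = 2) :
    M.core x = 2 ↔ M.towerSign x ≠ 1 := by
  have hmod := M.core_mod_two x
  have hle := M.core_le_two x
  rw [hx] at hmod
  have h02 : M.core x = 0 ∨ M.core x = 2 := by omega
  rw [show M.towerSign x = d0 M.negOne 2 (M.det x) by simp [towerSign, hx]]
  constructor
  · intro h2 h1
    have h0 := (M.core_eq_zero_iff x hx).mpr h1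
    omega
  · intro hne
    rcases h02 with h0 | h2
    · exact absurd ((M.core_eq_zero_iff x hx).mp h0) hne
    · exact h2

/-- In `ℤˣ` two distinct tower signs are `1` and `−1` in some order. -/
theorem towerSign_cases (x y : X) (h : M.towerSign x ≠ M.towerSign y) :
    (M.towerSign x = 1 ∧ M.towerSign y = -1) ∨ (M.towerSign x = -1 ∧ M.towerSign y = 1) := by
  rcases Int.units_eq_one_or (M.towerSign x) with hx | hx <;>
    rcases Int.units_eq_one_or (M.towerSign y) with hy | hy
  · exact absurd (hx.trans hy.symm) h
  · exact Or.inl ⟨hx, hy⟩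
  · exact Or.inr ⟨hx, hy⟩
  · exact absurd (hx.trans hy.symm) h

end LocalModel

end Summit.Ventures.HodgeRepro2.T5LocalHermitian
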